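import Summits.ResolutionOfSingularities.ResolutionOfSingularities.Theorems.SectionAscentFibrewiseClosedPointsTraceIdealDimThree
import Summits.ResolutionOfSingularities.ResolutionOfSingularities.Theorems.SectionAscentFibrewiseClosedPointsOneShotCurves
import HarnessLib

/-!
# Line `dimension-ladder` — the rung family specialises to the PROVED floor (witness file)

Crux stmt-ResolutionOfSingularities-15960 `SectionAscent.FibrewiseClosedPoints`; line
`Cruxes/FibrewiseClosedPoints/Lines/dimension_ladder.lean` (commit 585e738966d1); rung
`DimensionLadder.AffineFourfolds := Rung 4`.

This file is SELF-CONTAINED (single-file check): `RungAt` / `Rung` / `AffineFourfolds` below are the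
line's definitions VERBATIM (the in-module witnesses are `DimensionLadder.rung_three_of_printedFacts`
and `DimensionLadder.rung_of_le_three`).  It shows, with NO `sorry`, that the graded family
specialises to the proved levels:

* `rung_zero`, `rung_one` — levels `0` and `1` UNCONDITIONALLY (the landed conductor blow-up
  theorem `OneShotCurves.stub_oneShotCurves`);
* `rung_three` — the floor `θ₀ = 3` (affine threefolds) from exactly the two results in print
  vendored as named Literature facts, `CossartPiltant2019AffineOneBlowup` (Cossart–Piltant 2019
  Thm 1.1, affine case, with Liu 2002 Thm 8.1.24) and `CossartPiltant2019Principalization` (CP 2019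
  Prop. 4.3 of arXiv v1), through the landed re-centering theorem
  `TraceIdeal.oneShotBody_three_of_facts`.  Cossart–Piltant print this exact-centre statement as
  NOT KNOWN ("not even known if such π can be obtained by blowing up an ideal sheaf whose zero locus
  is Sing 𝒳, even when 𝒳 is affine", arXiv:1412.0868 p. 3); weak resolution (the summit `S`) IS
  known in dimension 3 (their Thm 1.1) — flagged `S known there: yes` in the line card.

[cite: CossartPiltant2019, Thm. 1.1, p. 3 and Prop. 4.3 (arXiv v1)]
-/

noncomputable section

set_option linter.dupNamespace false

open AlgebraicGeometry Literature.AlgebraicGeometry.Resolution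
open Summit.ResolutionOfSingularities.ResolutionOfSingularities.Theorems.SectionAscent.TraceIdeal
open Summit.ResolutionOfSingularities.ResolutionOfSingularities.Theorems.SectionAscent.OneShotCurves

namespace Summit.ResolutionOfSingularities.ResolutionOfSingularities.Cruxes.FibrewiseClosedPoints.DimensionLadder.Special

/-- VERBATIM copy of `DimensionLadder.RungAt` (level `n` at the field `K`). [folklore] -/
def RungAt (K : Type) [Field K] (n : ℕ) : Prop :=
  ∀ (A : Type) [CommRing A] [IsDomain A] [Algebra K A] [Algebra.FiniteType K A],
    ringKrullDim A = n → ∃ I : Ideal A, I ≠ ⊥ ∧ Scheme.IsRegular (affineBlowup I) ∧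
      ∀ 𝔭 : PrimeSpectrum A, I ≤ 𝔭.asIdeal ↔ ¬ IsRegularLocalRing (Localization.AtPrime 𝔭.asIdeal)

/-- VERBATIM copy of `DimensionLadder.Rung`. [folklore] -/
def Rung (n : ℕ) : Prop :=
  ∀ p : ℕ, p.Prime → ∀ (K : Type) [Field K] [CharP K p], RungAt K n

/-- VERBATIM copy of `DimensionLadder.AffineFourfolds` (the rung). [cite: CossartPiltant2019, §1] -/
def AffineFourfolds : Prop := Rung 4

/-- Level `0` of the ladder, unconditionally (fields). [folklore] -/
theorem rung_zero : Rung 0 :=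
  fun p hp K _ _ A _ _ _ _ hdim =>
    stub_oneShotCurves p hp K A (by rw [hdim]; exact_mod_cast (show (0 : ℕ) < 2 by norm_num))

/-- Level `1` of the ladder, unconditionally (affine curves: conductor blow-up). [folklore] -/
theorem rung_one : Rung 1 :=
  fun p hp K _ _ A _ _ _ _ hdim =>
    stub_oneShotCurves p hp K A (by rw [hdim]; exact_mod_cast (show (1 : ℕ) < 2 by norm_num))

/-- **The floor `θ₀ = 3` in the rung's shape**: `Rung 3` from the two named facts in print.
[cite: CossartPiltant2019, Thm. 1.1 and Prop. 4.3 (arXiv v1)] -/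
theorem rung_three (h : CossartPiltant2019AffineOneBlowup.{0})
    (hP : CossartPiltant2019Principalization.{0}) : Rung 3 :=
  fun _ _ K _ _ A _ _ _ _ hdim => oneShotBody_three_of_facts h hP K A (by exact_mod_cast hdim)

/-- The same, literally as the brief's `example : Rung θ₀` (θ₀ = 3). [cite: CossartPiltant2019, Thm. 1.1] -/
example (h : CossartPiltant2019AffineOneBlowup.{0}) (hP : CossartPiltant2019Principalization.{0}) :
    Rung 3 :=
  rung_three h hP

/-- And the rung is the next parameter value: `AffineFourfolds` is `Rung (3 + 1)` by `rfl`. [folklore] -/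
example : AffineFourfolds = Rung (3 + 1) := rfl

end Summit.ResolutionOfSingularities.ResolutionOfSingularities.Cruxes.FibrewiseClosedPoints.DimensionLadder.Special

end
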